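import Literature.MathematicalPhysics.QuantumFieldTheory.Federbush1986.RadialTreeParentMap

/-!
# `Federbush1986.RadialTreeConstruction` — [Federbush1987PhaseCellIII] §5.4 B) pp. 307–308, «Construction of a Radial
# Maximal Tree»: stages B/C of the PROOF of the typed row F3.Txt@307, `theorem radialTreeExists : RadialTree.RadialTreeExists`

statement-level skeleton of published theorems with citation tags; proofs where landed; nothing here is a claim about the Yang–Mills mass gap

CITATION HEADER.  P. Federbush, *A phase cell approach to Yang–Mills theory. III*, Commun. Math. Phys. **110** (1987)
293–309 [Federbush1987PhaseCellIII], §5.4 B) pp. 307–308 (OCR `…/texts/fed1987-cmp110-III/p015.txt`, `p016.txt`).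
Unit `lit-balaban-p25` gen 4; SKELETON row **F3.Txt@307** (`RadialTree.RadialTreeExists`, `LatticeGeometry.lean`
p239734, fold owner r17); stage A = `RadialTreeParentMap.lean` (this seat).  HOME `run/shared/lean/pub/lit-balaban/`.

WHAT IS PRINTED (pp. 307–308).  «Construction of a Radial Maximal Tree. We construct our tree by an inductive process. We
have trees T₁, T₂, … such that T_i ⊂ T_{i+1} and T_i ⊂ T. T_i is a maximal tree on the vertices lying within the ball B_i of
radius r_i = 2^i about the origin. … We select a set of lattice points p_α [on ∂B_i, mutual separations ≥ c₂, c₃-dense] …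
for each p_α draw a line through the origin and p_α, call this l_α. We pick a shortest path on the lattice t_{0α} …
connects p_α to a point within distance √d of the boundary of B_{i+1} … lies in (B_{i+1} − B_i) … maximum distance between a
point in t_{0α} and l_α is ≤ c₁ … We arrange our t_{0α} in a (finite) sequence, and expand these inductively … disjoint
trees t_{fα} hitting all vertices in (B_{i+1} − B_i). T_{i+1} is obtained from T_i and the t_{fα} by adding one bond for each
t_{fα} to join it to T_i. This has been what at first seems a rather complicated construction. But living with it for a
while one may see the resulting tree satisfies the three Radial Properties.»  No proof of the properties is printed.

THE CONSTRUCTION FORMALISED HERE (a deterministic version of the same architecture; what is proved is exactly the typed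
existence statement `RadialTreeExists`, so the specific tree is this formalisation's choice).  Shells are taken in the
sup-norm, `N ≤ ‖z‖_∞ < 2N`, `N = 2^i` (the print's `B_{i+1} − B_i`); each shell is cut into the `2d` face-cones
`|z_j| = ‖z‖_∞` (`j` = least maximal index, «height» `m = |z_j|`, the other coordinates «transverse»).  The spines (the
print's radial paths `t_{0α}`): for `u ≤ U(N) = ⌊(N−2)/3⌋` the transverse value `⌊3um/N⌋` at height `m` — a digital ray
through the origin, at transverse spacing between 3 and 6; a point is attached to the spine of its TUBE (index
`u_k = max{u : ⌊3um/N⌋ ≤ |z_k|}` in each transverse coordinate) by coordinate-monotone unit steps (the print's expansion of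
the spines to disjoint trees hitting all vertices), and the bottom of each spine (height `N`) is joined by one bond to the
shell below (the print's «one bond for each t_{fα}»).  Concretely the PARENT of `z ≠ 0` lowers by one, in absolute value,
the least transverse coordinate exceeding its spine value if there is one, and the height coordinate otherwise (`par`).
KEY INVARIANTS (§4): the face and, within a shell, every tube index `u_k` are constant along `par`; across a shell
boundary `u_k ↦ u'_k` with `2u'_k ≤ u_k ≤ 2u'_k + 2`.  Hence (§5) a descendant `q` of `p`, `‖q‖_∞ ∈ [2^eN, 2^{e+1}N)`,
has the face of `p` and tube indices in `[2^e u_k(p), 2^e(u_k(p)+2) − 2]`, and (§6) the descendants of `p` in the shell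
`2^eN` number `≤ 2^{e+1}N·(36·2^e)^d`; summing the geometric series up to `2^eN ≤ c₀r` and using `N > r/(2d)` gives
Radial Property 3 with `m(c₀) = 4(72d)^d c₀^{d+1}` (§7).  Radial Properties 1–2 and the tree property are stage A
(`LatticeParentMap.isRadial_of_count`, `isMaximalTree`).

WHAT THIS MODULE PROVES.  §1 shell/spine arithmetic (`shell`, `U`, `sv`, `ti` and the no-drift / halving lemmas);
§2 `supNorm`, `major`; §3 the parent map `par` and `radialMap : LatticeParentMap (n+1)`; §4 one-step invariants
(`par_data`); §5 `iterate_data`; §6 the counting boxes (`box`, `card_box_le`, `mem_box_of_isAnc`); §7 `count_bound`,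
`isRadial_radialMap`, and **`radialTreeExists : RadialTreeExists`** (row F3.Txt@307 PROVED AS TYPED, every `d ≥ 1`).
No `sorry`, no new `Prop`-valued named fact; axioms standard.
-/

namespace Literature.MathematicalPhysics.QuantumFieldTheory.Federbush1986

namespace RadialTree

open scoped BigOperators

noncomputable section

namespace Construction

/-! ## §1 Shells, spine values and tube indices (arithmetic) -/

/-- The dyadic shell of a height `m ≥ 1`: the power of two `N` with `N ≤ m < 2N` (the print's annulus `B_{i+1} − B_i`,
`r_i = 2^i`, read in the sup-norm). [cite: Federbush1987PhaseCellIII, §5.4 B) Construction p. 307] -/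
def shell (m : ℕ) : ℕ := 2 ^ Nat.log 2 m

/-- `shell m ≤ m` for `m ≥ 1`. [cite: Federbush1987PhaseCellIII, §5.4 B) Construction p. 307] -/
theorem shell_le {m : ℕ} (hm : m ≠ 0) : shell m ≤ m := Nat.pow_log_le_self 2 hm

/-- `m < 2·shell m`. [cite: Federbush1987PhaseCellIII, §5.4 B) Construction p. 307] -/
theorem lt_two_mul_shell (m : ℕ) : m < 2 * shell m := by
  rw [shell, mul_comm, ← pow_succ]; exact Nat.lt_pow_succ_log_self (by norm_num) m

/-- `shell m` is a positive power of two. [cite: Federbush1987PhaseCellIII, §5.4 B) Construction p. 307] -/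
theorem shell_pos (m : ℕ) : 0 < shell m := by unfold shell; positivity

/-- Characterisation of the shell. [cite: Federbush1987PhaseCellIII, §5.4 B) Construction p. 307] -/
theorem shell_eq_pow {m e : ℕ} (h1 : 2 ^ e ≤ m) (h2 : m < 2 ^ (e + 1)) : shell m = 2 ^ e := by
  rw [shell, Nat.log_eq_of_pow_le_of_lt_pow h1 h2]

/-- Inside a shell the shell does not change: `shell (m−1) = shell m` when `shell m < m`.
[cite: Federbush1987PhaseCellIII, §5.4 B) Construction p. 307] -/
theorem shell_pred_eq {m : ℕ} (h : shell m < m) : shell (m - 1) = shell m := by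
  have h2 := lt_two_mul_shell m
  have h' : 2 ^ Nat.log 2 m < m := h
  have h2' : m < 2 * 2 ^ Nat.log 2 m := h2
  change shell (m - 1) = 2 ^ Nat.log 2 m
  apply shell_eq_pow
  · omega
  · rw [pow_succ]; omega

/-- At the bottom of a shell the next height lies in the shell below: `shell (N−1) = N/2` for `N = shell N ≥ 2`.
[cite: Federbush1987PhaseCellIII, §5.4 B) Construction p. 307] -/
theorem shell_pred_of_eq {m : ℕ} (h : shell m = m) (hm : 2 ≤ m) : 2 * shell (m - 1) = m := by
  have hlog : Nat.log 2 m ≠ 0 := by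
    intro h0; rw [shell, h0, pow_zero] at h; omega
  obtain ⟨e, he⟩ := Nat.exists_eq_succ_of_ne_zero hlog
  rw [shell, he, pow_succ] at h
  have : shell (m - 1) = 2 ^ e := by
    apply shell_eq_pow <;> [skip; rw [pow_succ]] <;> omega
  rw [this]; omega

/-- The number of non-axial spines per transverse coordinate in the shell `N`: `U(N) = ⌊(N−2)/3⌋` (so `3U ≤ N − 2`).
[cite: Federbush1987PhaseCellIII, §5.4 B) Construction p. 307] -/
def U (N : ℕ) : ℕ := (N - 2) / 3

/-- `3·U(N) ≤ N − 2`. [cite: Federbush1987PhaseCellIII, §5.4 B) Construction p. 307] -/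
theorem three_mul_U_le (N : ℕ) : 3 * U N ≤ N - 2 := Nat.mul_div_le (N - 2) 3

/-- The transverse value of the `u`-th spine at height `m` in the shell `N`: `⌊3um/N⌋` (a digital ray through the origin
— the print's «shortest path … maximum distance between a point in t_{0α} and l_α is ≤ c₁»).
[cite: Federbush1987PhaseCellIII, §5.4 B) Construction p. 307] -/
def sv (u m N : ℕ) : ℕ := 3 * u * m / N

/-- The tube index of a transverse value `a` at height `m` in the shell `N`: the largest `u ≤ U(N)` whose spine lies at or
below `a` (the tree `t_{fα}` a vertex is attached to). [cite: Federbush1987PhaseCellIII, §5.4 B) Construction p. 307] -/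
def ti (a m N : ℕ) : ℕ := Nat.findGreatest (fun u => sv u m N ≤ a) (U N)

/-- Monotonicity of the spine value in the spine index. [cite: Federbush1987PhaseCellIII, §5.4 B) p. 307] -/
theorem sv_mono_u {u u' : ℕ} (h : u ≤ u') (m N : ℕ) : sv u m N ≤ sv u' m N :=
  Nat.div_le_div_right (Nat.mul_le_mul_right _ (Nat.mul_le_mul_left _ h))

/-- Monotonicity of the spine value in the height. [cite: Federbush1987PhaseCellIII, §5.4 B) p. 307] -/
theorem sv_mono_m (u : ℕ) {m m' : ℕ} (h : m ≤ m') (N : ℕ) : sv u m N ≤ sv u m' N :=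
  Nat.div_le_div_right (Nat.mul_le_mul_left _ h)

/-- `sv 0 = 0`. [cite: Federbush1987PhaseCellIII, §5.4 B) p. 307] -/
@[simp] theorem sv_zero (m N : ℕ) : sv 0 m N = 0 := by simp [sv]

/-- At the bottom of the shell the `u`-th spine sits at `3u`. [cite: Federbush1987PhaseCellIII, §5.4 B) p. 307] -/
theorem sv_self {N : ℕ} (hN : 0 < N) (u : ℕ) : sv u N N = 3 * u := by
  rw [sv, Nat.mul_div_cancel _ hN]

/-- The top spine stays two below the height (so spine steps never change the face): `sv (U N) m N ≤ m − 2` for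
`1 ≤ N ≤ m`. [cite: Federbush1987PhaseCellIII, §5.4 B) p. 307] -/
theorem sv_U_le {N m : ℕ} (hN : 0 < N) (hm : N ≤ m) : sv (U N) m N ≤ m - 2 := by
  unfold sv
  apply Nat.div_le_of_le_mul
  have h3 := three_mul_U_le N
  rcases Nat.lt_or_ge N 3 with hN3 | hN3
  · have : U N = 0 := by unfold U; omega
    rw [this]; simp
  · have h1 : 3 * U N * m ≤ (N - 2) * m := Nat.mul_le_mul_right _ h3
    have h2 : (N - 2) * m ≤ N * (m - 2) := by
      zify [(by omega : 2 ≤ N), (by omega : 2 ≤ m)]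
      nlinarith
    exact h1.trans h2

/-- Characterisation of the tube index. [cite: Federbush1987PhaseCellIII, §5.4 B) p. 307] -/
theorem ti_eq_iff {a m N u : ℕ} :
    ti a m N = u ↔ u ≤ U N ∧ sv u m N ≤ a ∧ (u < U N → a < sv (u + 1) m N) := by
  rw [ti, Nat.findGreatest_eq_iff]
  constructor
  · rintro ⟨h1, h2, h3⟩
    refine ⟨h1, ?_, fun hu => ?_⟩
    · rcases Nat.eq_zero_or_pos u with rfl | hu
      · simp
      · exact h2 hu.ne'
    · exact Nat.lt_of_not_le (h3 (Nat.lt_succ_self u) hu)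
  · rintro ⟨h1, h2, h3⟩
    refine ⟨h1, fun _ => h2, fun k hk hkU hle => ?_⟩
    have := h3 (lt_of_lt_of_le hk hkU)
    exact absurd (le_trans (sv_mono_u hk m N) hle) (Nat.not_le.2 this)

/-- `ti a m N ≤ U N`. [cite: Federbush1987PhaseCellIII, §5.4 B) p. 307] -/
theorem ti_le_U (a m N : ℕ) : ti a m N ≤ U N := (ti_eq_iff.1 rfl).1

/-- The spine of the tube lies at or below the point. [cite: Federbush1987PhaseCellIII, §5.4 B) p. 307] -/
theorem sv_ti_le (a m N : ℕ) : sv (ti a m N) m N ≤ a := (ti_eq_iff.1 rfl).2.1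

/-- The next spine lies strictly above the point. [cite: Federbush1987PhaseCellIII, §5.4 B) p. 307] -/
theorem lt_sv_succ_of_ti_lt {a m N : ℕ} (h : ti a m N < U N) : a < sv (ti a m N + 1) m N :=
  (ti_eq_iff.1 rfl).2.2 h

/-- A transverse unit step towards the spine does not change the tube (feeder steps stay in their tube).
[cite: Federbush1987PhaseCellIII, §5.4 B) p. 308] -/
theorem ti_pred {a m N : ℕ} (h : sv (ti a m N) m N < a) : ti (a - 1) m N = ti a m N := by
  rw [ti_eq_iff]
  refine ⟨ti_le_U a m N, by omega, fun hu => ?_⟩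
  have := lt_sv_succ_of_ti_lt hu; omega

/-- NO DRIFT inside a shell: one height step down from a spine point, the point is still in the same tube
(`3um/N + 1 ≤ 3(u+1)(m−1)/N`). [cite: Federbush1987PhaseCellIII, §5.4 B) p. 308] -/
theorem ti_sv_pred {u m N : ℕ} (hN : 0 < N) (hm : N + 1 ≤ m) (hu : u ≤ U N) :
    ti (sv u m N) (m - 1) N = u := by
  rw [ti_eq_iff]
  refine ⟨hu, sv_mono_m u (Nat.sub_le m 1) N, fun huU => ?_⟩
  have h3 := three_mul_U_le N
  unfold sv
  have key : 3 * u * m + N ≤ 3 * (u + 1) * (m - 1) := by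
    zify [(by omega : 1 ≤ m), (by omega : 2 ≤ N)] at h3 hm hu huU ⊢
    nlinarith
  calc 3 * u * m / N < 3 * u * m / N + 1 := Nat.lt_succ_self _
    _ = (3 * u * m + N) / N := (Nat.add_div_right _ hN).symm
    _ ≤ 3 * (u + 1) * (m - 1) / N := Nat.div_le_div_right key

/-- `U(2N') ≤ 2U(N') + 2`. [cite: Federbush1987PhaseCellIII, §5.4 B) p. 307] -/
theorem U_two_mul_le (N' : ℕ) : U (2 * N') ≤ 2 * U N' + 2 := by unfold U; omega

/-- HALVING across a shell boundary: the bottom of the `u`-th spine of the shell `2N'` (transverse value `3u` at height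
`2N'`), moved one height step down into the shell `N'`, lies in the tube `u'` with `2u' ≤ u ≤ 2u' + 2` (the print's «one
bond for each t_{fα} to join it to T_i»). [cite: Federbush1987PhaseCellIII, §5.4 B) p. 308] -/
theorem ti_transition {u N' : ℕ} (hN : 0 < N') (hu : u ≤ U (2 * N')) :
    2 * ti (3 * u) (2 * N' - 1) N' ≤ u ∧ u ≤ 2 * ti (3 * u) (2 * N' - 1) N' + 2 := by
  set u' := ti (3 * u) (2 * N' - 1) N' with hu'
  obtain ⟨h1, h2, h3⟩ := ti_eq_iff.1 hu'.symm
  have hU' := three_mul_U_le N'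
  constructor
  · -- `(6u' − 1) N' ≤ 3u'(2N'−1)` hence `6u' − 1 ≤ 3u`
    rcases Nat.eq_zero_or_pos u' with h0 | h0
    · omega
    · have key : (6 * u' - 1) * N' ≤ 3 * u' * (2 * N' - 1) := by
        zify [(by omega : 1 ≤ 6 * u'), (by omega : 1 ≤ 2 * N')]
        zify [(by omega : 2 ≤ N')] at hU' h1
        nlinarith
      have h4 : 6 * u' - 1 ≤ sv u' (2 * N' - 1) N' := (Nat.le_div_iff_mul_le hN).2 key
      omega
  · rcases Nat.lt_or_ge u' (U N') with hlt | hge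
    · have h4 := h3 hlt
      have h5 : sv (u' + 1) (2 * N' - 1) N' ≤ 6 * (u' + 1) := by
        unfold sv
        apply Nat.div_le_of_le_mul
        have : 2 * N' - 1 ≤ 2 * N' := Nat.sub_le _ _
        calc 3 * (u' + 1) * (2 * N' - 1) ≤ 3 * (u' + 1) * (2 * N') := Nat.mul_le_mul_left _ this
          _ = N' * (6 * (u' + 1)) := by ring
      omega
    · have : u' = U N' := le_antisymm h1 hge
      have := U_two_mul_le N'
      omega

/-- Width of a tube: all transverse values of the tube `u` at height `m` (shell `M`) lie in `[sv u, sv u + 8]`.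
[cite: Federbush1987PhaseCellIII, §5.4 B) p. 307] -/
theorem le_sv_ti_add {a m M : ℕ} (hM : 0 < M) (hm : m < 2 * M) (ha : a ≤ m) :
    a ≤ sv (ti a m M) m M + 8 := by
  set u := ti a m M with hu
  rcases Nat.lt_or_ge u (U M) with hlt | hge
  · have h1 := lt_sv_succ_of_ti_lt hlt
    have h2 : sv (u + 1) m M ≤ sv u m M + 6 := by
      unfold sv
      have h3 : 3 * (u + 1) * m = 3 * u * m + 3 * m := by ring
      rw [h3]
      calc (3 * u * m + 3 * m) / M ≤ 3 * u * m / M + 3 * m / M + 1 := by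
              rw [Nat.add_div hM]; split_ifs <;> omega
        _ ≤ 3 * u * m / M + 5 + 1 := by
              have : 3 * m / M ≤ 5 := by
                apply Nat.le_of_lt_succ
                exact (Nat.div_lt_iff_lt_mul hM).2 (by omega)
              omega
        _ = 3 * u * m / M + 6 := by ring
    rw [← hu] at h1; omega
  · have hU : u = U M := le_antisymm (ti_le_U a m M) hge
    have h3 := three_mul_U_le M
    -- `m ≤ sv (U M) m M + 8`
    have key : m ≤ sv u m M + 8 := by
      rw [hU]; unfold sv
      rcases Nat.lt_or_ge M 4 with hM4 | hM4
      · have hU0 : U M = 0 := by unfold U; omega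
        rw [hU0]; simp only [mul_zero, zero_mul, Nat.zero_div, zero_add]; omega
      · have h4 : M - 4 ≤ 3 * U M := by unfold U; omega
        have h5 : (M - 4) * m / M ≤ 3 * U M * m / M :=
          Nat.div_le_div_right (Nat.mul_le_mul_right _ h4)
        have h6 : m ≤ (M - 4) * m / M + 8 := by
          have : m * M ≤ (M - 4) * m + 8 * M := by
            zify [hM4]; nlinarith
          calc m = m * M / M := (Nat.mul_div_cancel _ hM).symm
            _ ≤ ((M - 4) * m + 8 * M) / M := Nat.div_le_div_right this
            _ = (M - 4) * m / M + 8 := Nat.add_mul_div_right _ _ hM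
        omega
    omega

/-! ## §2 Heights and faces: the sup-norm and the major index -/

variable {n : ℕ}

/-- The sup-norm `‖z‖_∞` of a lattice point (the «height» of the print's shells, read in the sup-norm).
[cite: Federbush1987PhaseCellIII, §5.4 B) Construction p. 307] -/
def supNorm (z : Fin (n + 1) → ℤ) : ℕ := Finset.univ.sup fun i => (z i).natAbs

/-- Every coordinate is bounded by the sup-norm. [cite: Federbush1987PhaseCellIII, §5.4 B) p. 307] -/
theorem natAbs_le_supNorm (z : Fin (n + 1) → ℤ) (i : Fin (n + 1)) : (z i).natAbs ≤ supNorm z :=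
  Finset.le_sup (f := fun i => (z i).natAbs) (Finset.mem_univ i)

/-- The indices where the sup-norm is attained. [cite: Federbush1987PhaseCellIII, §5.4 B) p. 307] -/
def argmax (z : Fin (n + 1) → ℤ) : Finset (Fin (n + 1)) :=
  Finset.univ.filter fun i => (z i).natAbs = supNorm z

/-- The sup-norm is attained. [cite: Federbush1987PhaseCellIII, §5.4 B) p. 307] -/
theorem argmax_nonempty (z : Fin (n + 1) → ℤ) : (argmax z).Nonempty := by
  obtain ⟨i, -, hi⟩ := Finset.exists_mem_eq_sup (Finset.univ : Finset (Fin (n + 1))) Finset.univ_nonempty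
    (fun i => (z i).natAbs)
  exact ⟨i, Finset.mem_filter.2 ⟨Finset.mem_univ i, hi.symm⟩⟩

/-- The major index of a point: the least index at which the sup-norm is attained (the face-cone of the point).
[cite: Federbush1987PhaseCellIII, §5.4 B) Construction p. 307] -/
def major (z : Fin (n + 1) → ℤ) : Fin (n + 1) := (argmax z).min' (argmax_nonempty z)

/-- The major coordinate attains the sup-norm. [cite: Federbush1987PhaseCellIII, §5.4 B) p. 307] -/
theorem natAbs_major (z : Fin (n + 1) → ℤ) : (z (major z)).natAbs = supNorm z := by
  have := Finset.min'_mem (argmax z) (argmax_nonempty z)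
  exact (Finset.mem_filter.1 this).2

/-- The major index is the least maximal index. [cite: Federbush1987PhaseCellIII, §5.4 B) p. 307] -/
theorem major_le {z : Fin (n + 1) → ℤ} {i : Fin (n + 1)} (hi : (z i).natAbs = supNorm z) : major z ≤ i :=
  Finset.min'_le _ _ (Finset.mem_filter.2 ⟨Finset.mem_univ i, hi⟩)

/-- Characterisation of the major index. [cite: Federbush1987PhaseCellIII, §5.4 B) p. 307] -/
theorem major_eq_of {z : Fin (n + 1) → ℤ} {j : Fin (n + 1)} (hj : (z j).natAbs = supNorm z)
    (hmin : ∀ i, (z i).natAbs = supNorm z → j ≤ i) : major z = j :=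
  le_antisymm (major_le hj) (hmin _ (natAbs_major z))

/-- `‖z‖_∞ = 0 ↔ z = 0`. [cite: Federbush1987PhaseCellIII, §5.4 B) p. 307] -/
theorem supNorm_eq_zero_iff (z : Fin (n + 1) → ℤ) : supNorm z = 0 ↔ z = 0 := by
  constructor
  · intro h; funext i
    have := natAbs_le_supNorm z i
    rw [h, Nat.le_zero, Int.natAbs_eq_zero] at this
    exact this
  · rintro rfl; simp [supNorm]

/-- Characterisation of the sup-norm. [cite: Federbush1987PhaseCellIII, §5.4 B) p. 307] -/
theorem supNorm_eq_of {z : Fin (n + 1) → ℤ} {m : ℕ} (h1 : ∀ i, (z i).natAbs ≤ m) (h2 : ∃ i, (z i).natAbs = m) :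
    supNorm z = m := by
  apply le_antisymm (Finset.sup_le fun i _ => h1 i)
  obtain ⟨i, hi⟩ := h2
  rw [← hi]; exact natAbs_le_supNorm z i

/-! ## §3 The parent map -/

/-- The tube index of the coordinate `k` of `z` (in the shell and at the height of `z`).
[cite: Federbush1987PhaseCellIII, §5.4 B) Construction p. 307] -/
def tIdx (z : Fin (n + 1) → ℤ) (k : Fin (n + 1)) : ℕ := ti (z k).natAbs (supNorm z) (shell (supNorm z))

/-- The spine value of the tube of the coordinate `k` of `z`. [cite: Federbush1987PhaseCellIII, §5.4 B) p. 307] -/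
def tVal (z : Fin (n + 1) → ℤ) (k : Fin (n + 1)) : ℕ := sv (tIdx z k) (supNorm z) (shell (supNorm z))

/-- The transverse coordinates still above their spine (to be lowered first — the attachment of a vertex to its spine).
[cite: Federbush1987PhaseCellIII, §5.4 B) Construction p. 308] -/
def fixSet (z : Fin (n + 1) → ℤ) : Finset (Fin (n + 1)) :=
  Finset.univ.filter fun k => k ≠ major z ∧ tVal z k < (z k).natAbs

/-- The coordinate moved by the parent step: the least transverse coordinate above its spine, else the height.
[cite: Federbush1987PhaseCellIII, §5.4 B) Construction p. 308] -/
def stepIdx (z : Fin (n + 1) → ℤ) : Fin (n + 1) :=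
  if h : (fixSet z).Nonempty then (fixSet z).min' h else major z

/-- THE PARENT MAP of the radial tree: lower the coordinate `stepIdx z` by one in absolute value.
[cite: Federbush1987PhaseCellIII, §5.4 B) Construction pp. 307–308] -/
def par (z : Fin (n + 1) → ℤ) : Fin (n + 1) → ℤ :=
  if z = 0 then 0 else Function.update z (stepIdx z) (z (stepIdx z) - Int.sign (z (stepIdx z)))

/-- The spine of a coordinate's tube lies at or below the coordinate. [cite: Federbush1987PhaseCellIII, §5.4 B) pp. 307–308] -/
theorem tVal_le (z : Fin (n + 1) → ℤ) (k : Fin (n + 1)) : tVal z k ≤ (z k).natAbs := sv_ti_le _ _ _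

/-- The two kinds of parent steps: a FEEDER step (a transverse coordinate above its spine) or a SPINE step (the
height). [cite: Federbush1987PhaseCellIII, §5.4 B) Construction p. 308] -/
theorem stepIdx_cases (z : Fin (n + 1) → ℤ) :
    (stepIdx z ∈ fixSet z) ∨ (fixSet z = ∅ ∧ stepIdx z = major z) := by
  unfold stepIdx
  split_ifs with h
  · exact Or.inl (Finset.min'_mem _ h)
  · exact Or.inr ⟨Finset.not_nonempty_iff_eq_empty.1 h, rfl⟩

/-- Non-zero points have positive height. [cite: Federbush1987PhaseCellIII, §5.4 B) pp. 307–308] -/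
theorem supNorm_pos {z : Fin (n + 1) → ℤ} (hz : z ≠ 0) : 0 < supNorm z :=
  Nat.pos_of_ne_zero fun h => hz ((supNorm_eq_zero_iff z).1 h)

/-- The coordinate moved by the parent step is non-zero. [cite: Federbush1987PhaseCellIII, §5.4 B) pp. 307–308] -/
theorem natAbs_stepIdx_pos {z : Fin (n + 1) → ℤ} (hz : z ≠ 0) : 0 < (z (stepIdx z)).natAbs := by
  rcases stepIdx_cases z with h | ⟨-, h⟩
  · have := (Finset.mem_filter.1 h).2.2; omega
  · rw [h, natAbs_major]; exact supNorm_pos hz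

/-- The parent of a non-zero point, unfolded. [cite: Federbush1987PhaseCellIII, §5.4 B) pp. 307–308] -/
theorem par_of_ne_zero {z : Fin (n + 1) → ℤ} (hz : z ≠ 0) :
    par z = Function.update z (stepIdx z) (z (stepIdx z) - Int.sign (z (stepIdx z))) := if_neg hz

/-- The radial tree as a lattice parent map (stage A): unit coordinate steps towards the origin.
[cite: Federbush1987PhaseCellIII, §5.4 B) Construction pp. 307–308] -/
def radialMap (n : ℕ) : LatticeParentMap (n + 1) where
  par := par
  par_zero := if_pos rfl
  step z hz := ⟨stepIdx z, by
    have := natAbs_stepIdx_pos hz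
    exact Int.natAbs_pos.1 this, par_of_ne_zero hz⟩

/-- Coordinates of the parent. [cite: Federbush1987PhaseCellIII, §5.4 B) p. 308] -/
theorem natAbs_par_apply {z : Fin (n + 1) → ℤ} (hz : z ≠ 0) (i : Fin (n + 1)) :
    (par z i).natAbs = if i = stepIdx z then (z i).natAbs - 1 else (z i).natAbs := by
  rw [par_of_ne_zero hz]
  split_ifs with h
  · subst h
    rw [Function.update_self]
    have := LatticeParentMap.natAbs_sub_sign (z (stepIdx z)) (Int.natAbs_pos.1 (natAbs_stepIdx_pos hz))
    omega
  · rw [Function.update_of_ne h]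

/-- The parent step changes only the coordinate `stepIdx z`. [cite: Federbush1987PhaseCellIII, §5.4 B) pp. 307–308] -/
theorem par_apply_of_ne {z : Fin (n + 1) → ℤ} (hz : z ≠ 0) {i : Fin (n + 1)} (h : i ≠ stepIdx z) :
    par z i = z i := by
  rw [par_of_ne_zero hz, Function.update_of_ne h]

/-! ## §4 One parent step: the face is kept, tube indices are kept inside a shell and halve across shells -/

section OneStep

variable {z : Fin (n + 1) → ℤ}

/-- Membership in the set of transverse coordinates above their spines. [cite: Federbush1987PhaseCellIII, §5.4 B) pp. 307–308] -/
theorem mem_fixSet_iff {k : Fin (n + 1)} : k ∈ fixSet z ↔ k ≠ major z ∧ tVal z k < (z k).natAbs := by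
  simp [fixSet]

/-- FEEDER step: the height is unchanged. [cite: Federbush1987PhaseCellIII, §5.4 B) Construction p. 308] -/
theorem supNorm_par_of_mem (hz : z ≠ 0) (hA : stepIdx z ∈ fixSet z) : supNorm (par z) = supNorm z := by
  obtain ⟨hkj, -⟩ := mem_fixSet_iff.1 hA
  apply supNorm_eq_of
  · intro i
    rw [natAbs_par_apply hz]
    split_ifs
    · exact (Nat.sub_le _ _).trans (natAbs_le_supNorm z i)
    · exact natAbs_le_supNorm z i
  · refine ⟨major z, ?_⟩
    rw [natAbs_par_apply hz, if_neg (Ne.symm hkj), natAbs_major]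

/-- FEEDER step: the face is unchanged. [cite: Federbush1987PhaseCellIII, §5.4 B) Construction p. 308] -/
theorem major_par_of_mem (hz : z ≠ 0) (hA : stepIdx z ∈ fixSet z) : major (par z) = major z := by
  obtain ⟨hkj, -⟩ := mem_fixSet_iff.1 hA
  apply major_eq_of
  · rw [supNorm_par_of_mem hz hA, natAbs_par_apply hz, if_neg (Ne.symm hkj), natAbs_major]
  · intro i hi
    rw [supNorm_par_of_mem hz hA, natAbs_par_apply hz] at hi
    split_ifs at hi with h
    · have := natAbs_le_supNorm z i; have := supNorm_pos hz; omega
    · exact major_le hi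

/-- FEEDER step: every tube index is unchanged (feeder steps stay in their tube).
[cite: Federbush1987PhaseCellIII, §5.4 B) Construction p. 308] -/
theorem tIdx_par_of_mem (hz : z ≠ 0) (hA : stepIdx z ∈ fixSet z) (k : Fin (n + 1)) :
    tIdx (par z) k = tIdx z k := by
  obtain ⟨-, hlt⟩ := mem_fixSet_iff.1 hA
  unfold tIdx
  rw [supNorm_par_of_mem hz hA, natAbs_par_apply hz]
  split_ifs with h
  · subst h; exact ti_pred hlt
  · rfl

/-- SPINE step: all transverse coordinates sit on their spines, at least two below the height.
[cite: Federbush1987PhaseCellIII, §5.4 B) Construction p. 308] -/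
theorem transverse_of_fixSet_eq_empty (hz : z ≠ 0) (hB : fixSet z = ∅) {k : Fin (n + 1)} (hk : k ≠ major z) :
    (z k).natAbs = tVal z k ∧ tVal z k ≤ supNorm z - 2 := by
  have h1 : ¬ (tVal z k < (z k).natAbs) := by
    intro h
    have : k ∈ fixSet z := mem_fixSet_iff.2 ⟨hk, h⟩
    rw [hB] at this; exact absurd this (Finset.notMem_empty k)
  have h2 := tVal_le z k
  refine ⟨by omega, ?_⟩
  have hm := supNorm_pos hz
  calc tVal z k ≤ sv (U (shell (supNorm z))) (supNorm z) (shell (supNorm z)) :=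
        sv_mono_u (ti_le_U _ _ _) _ _
    _ ≤ supNorm z - 2 := sv_U_le (shell_pos _) (shell_le hm.ne')

/-- SPINE step: coordinates of the parent. [cite: Federbush1987PhaseCellIII, §5.4 B) Construction p. 308] -/
theorem natAbs_par_of_empty (hz : z ≠ 0) (hB : fixSet z = ∅ ∧ stepIdx z = major z) (i : Fin (n + 1)) :
    (par z i).natAbs = if i = major z then supNorm z - 1 else (z i).natAbs := by
  rw [natAbs_par_apply hz, hB.2]
  split_ifs with h
  · rw [h, natAbs_major]
  · rfl

/-- SPINE step at height one reaches the origin. [cite: Federbush1987PhaseCellIII, §5.4 B) Construction p. 308] -/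
theorem par_eq_zero_of_empty (hz : z ≠ 0) (hB : fixSet z = ∅ ∧ stepIdx z = major z) (hm : supNorm z = 1) :
    par z = 0 := by
  funext i
  have h := natAbs_par_of_empty hz hB i
  apply Int.natAbs_eq_zero.1
  rw [h]
  split_ifs with hi
  · omega
  · have := (transverse_of_fixSet_eq_empty hz hB.1 hi).2
    have := (transverse_of_fixSet_eq_empty hz hB.1 hi).1
    omega

/-- SPINE step: the height drops by one. [cite: Federbush1987PhaseCellIII, §5.4 B) Construction p. 308] -/
theorem supNorm_par_of_empty (hz : z ≠ 0) (hB : fixSet z = ∅ ∧ stepIdx z = major z) (hm : 2 ≤ supNorm z) :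
    supNorm (par z) = supNorm z - 1 := by
  apply supNorm_eq_of
  · intro i
    rw [natAbs_par_of_empty hz hB]
    split_ifs with hi
    · exact le_rfl
    · have h1 := transverse_of_fixSet_eq_empty hz hB.1 hi
      omega
  · exact ⟨major z, by rw [natAbs_par_of_empty hz hB, if_pos rfl]⟩

/-- SPINE step: the face is unchanged (the transverse coordinates are two below the old height).
[cite: Federbush1987PhaseCellIII, §5.4 B) Construction p. 308] -/
theorem major_par_of_empty (hz : z ≠ 0) (hB : fixSet z = ∅ ∧ stepIdx z = major z) (hm : 2 ≤ supNorm z) :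
    major (par z) = major z := by
  apply major_eq_of
  · rw [supNorm_par_of_empty hz hB hm, natAbs_par_of_empty hz hB, if_pos rfl]
  · intro i hi
    rw [supNorm_par_of_empty hz hB hm, natAbs_par_of_empty hz hB] at hi
    split_ifs at hi with h
    · exact h ▸ le_rfl
    · have h1 := transverse_of_fixSet_eq_empty hz hB.1 h
      omega

/-- SPINE step INSIDE a shell: every tube index is unchanged (no drift).
[cite: Federbush1987PhaseCellIII, §5.4 B) Construction p. 308] -/
theorem tIdx_par_of_empty_of_lt (hz : z ≠ 0) (hB : fixSet z = ∅ ∧ stepIdx z = major z)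
    (hlt : shell (supNorm z) < supNorm z) {k : Fin (n + 1)} (hk : k ≠ major z) :
    shell (supNorm (par z)) = shell (supNorm z) ∧ tIdx (par z) k = tIdx z k := by
  have hm : 2 ≤ supNorm z := by have := shell_pos (supNorm z); omega
  have hs : shell (supNorm (par z)) = shell (supNorm z) := by
    rw [supNorm_par_of_empty hz hB hm]; exact shell_pred_eq hlt
  refine ⟨hs, ?_⟩
  have h1 := transverse_of_fixSet_eq_empty hz hB.1 hk
  show ti (par z k).natAbs (supNorm (par z)) (shell (supNorm (par z))) = tIdx z k
  rw [hs, natAbs_par_of_empty hz hB, if_neg hk, supNorm_par_of_empty hz hB hm, h1.1]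
  exact ti_sv_pred (u := tIdx z k) (m := supNorm z) (N := shell (supNorm z)) (shell_pos _) (by omega)
    (ti_le_U _ _ _)

/-- SPINE step at the BOTTOM of a shell (one bond into the shell below): the shell halves and every tube index
`u ↦ u'` with `2u' ≤ u ≤ 2u' + 2`. [cite: Federbush1987PhaseCellIII, §5.4 B) Construction p. 308] -/
theorem tIdx_par_of_empty_of_eq (hz : z ≠ 0) (hB : fixSet z = ∅ ∧ stepIdx z = major z)
    (heq : shell (supNorm z) = supNorm z) (hm : 2 ≤ supNorm z) {k : Fin (n + 1)} (hk : k ≠ major z) :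
    2 * shell (supNorm (par z)) = shell (supNorm z) ∧
      2 * tIdx (par z) k ≤ tIdx z k ∧ tIdx z k ≤ 2 * tIdx (par z) k + 2 := by
  have hsp : supNorm (par z) = supNorm z - 1 := supNorm_par_of_empty hz hB hm
  have hs : 2 * shell (supNorm (par z)) = supNorm z := by rw [hsp]; exact shell_pred_of_eq heq hm
  refine ⟨by rw [hs, heq], ?_⟩
  have hN'pos : 0 < shell (supNorm (par z)) := shell_pos _
  have h1 := transverse_of_fixSet_eq_empty hz hB.1 hk
  have hval : (z k).natAbs = 3 * tIdx z k := by
    rw [h1.1]; unfold tVal; rw [heq, sv_self (supNorm_pos hz)]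
  have hU : tIdx z k ≤ U (2 * shell (supNorm (par z))) := by
    rw [hs, ← heq]; exact ti_le_U _ _ _
  have key : tIdx (par z) k =
      ti (3 * tIdx z k) (2 * shell (supNorm (par z)) - 1) (shell (supNorm (par z))) := by
    show ti (par z k).natAbs (supNorm (par z)) (shell (supNorm (par z))) = _
    rw [natAbs_par_of_empty hz hB, if_neg hk, hval, hs, hsp]
  rw [key]
  exact ti_transition hN'pos hU

/-- ONE PARENT STEP (all cases): the face is kept; either the shell and all tube indices are kept, or the shell halves
and the tube indices halve (`2u' ≤ u ≤ 2u' + 2`). [cite: Federbush1987PhaseCellIII, §5.4 B) Construction pp. 307–308] -/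
theorem par_data (hz : z ≠ 0) (hpz : par z ≠ 0) :
    major (par z) = major z ∧
    ((shell (supNorm (par z)) = shell (supNorm z) ∧ ∀ k, k ≠ major z → tIdx (par z) k = tIdx z k) ∨
     (2 * shell (supNorm (par z)) = shell (supNorm z) ∧
        ∀ k, k ≠ major z → 2 * tIdx (par z) k ≤ tIdx z k ∧ tIdx z k ≤ 2 * tIdx (par z) k + 2)) := by
  rcases stepIdx_cases z with hA | hB
  · exact ⟨major_par_of_mem hz hA, Or.inl ⟨by rw [supNorm_par_of_mem hz hA],
      fun k _ => tIdx_par_of_mem hz hA k⟩⟩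
  · have hm : 2 ≤ supNorm z := by
      have h1 := supNorm_pos hz
      by_contra h
      exact hpz (par_eq_zero_of_empty hz hB (by omega))
    refine ⟨major_par_of_empty hz hB hm, ?_⟩
    rcases (shell_le (supNorm_pos hz).ne').lt_or_eq with hlt | heq
    · refine Or.inl ⟨?_, fun k hk => (tIdx_par_of_empty_of_lt hz hB hlt hk).2⟩
      rw [supNorm_par_of_empty hz hB hm]; exact shell_pred_eq hlt
    · refine Or.inr ⟨?_, fun k hk => (tIdx_par_of_empty_of_eq hz hB heq hm hk).2⟩
      rw [supNorm_par_of_empty hz hB hm, heq]; exact shell_pred_of_eq heq hm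

end OneStep

/-! ## §5 Descendants: the face of a descendant, its shell `2^e N` and its tube indices -/

/-- Along the parent chain the face is constant, the shell is divided by `2^e`, and the tube indices of the descendant
lie in `[2^e u, 2^e(u+2) − 2]` where `u` are the tube indices of the ancestor.
[cite: Federbush1987PhaseCellIII, §5.4 B) Construction pp. 307–308] -/
theorem iterate_data (t : ℕ) (q : Fin (n + 1) → ℤ) (hp : par^[t] q ≠ 0) :
    major (par^[t] q) = major q ∧
    ∃ e : ℕ, shell (supNorm q) = 2 ^ e * shell (supNorm (par^[t] q)) ∧
      ∀ k, k ≠ major q →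
        2 ^ e * tIdx (par^[t] q) k ≤ tIdx q k ∧ tIdx q k + 2 ≤ 2 ^ e * (tIdx (par^[t] q) k + 2) := by
  induction t generalizing q with
  | zero => exact ⟨rfl, 0, by simp, fun k _ => by simp⟩
  | succ t ih =>
    rw [Function.iterate_succ_apply] at hp ⊢
    have h0 : ∀ s : ℕ, par^[s] (0 : Fin (n + 1) → ℤ) = 0 := fun s =>
      (radialMap n).toParentMap.iterate_par_root s
    have hq : q ≠ 0 := by
      rintro rfl
      exact hp (by rw [show par (0 : Fin (n + 1) → ℤ) = 0 from (radialMap n).par_zero]; exact h0 t)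
    have hpq : par q ≠ 0 := by
      intro h; exact hp (by rw [h]; exact h0 t)
    obtain ⟨hmaj, e, he, hidx⟩ := ih (par q) hp
    obtain ⟨hmaj1, hstep⟩ := par_data hq hpq
    refine ⟨hmaj.trans hmaj1, ?_⟩
    rcases hstep with ⟨hs, hk⟩ | ⟨hs, hk⟩
    · refine ⟨e, by rw [← hs, he], fun k hkj => ?_⟩
      have h1 := hidx k (by rw [hmaj1]; exact hkj)
      rw [hk k hkj] at h1
      exact h1
    · refine ⟨e + 1, by rw [← hs, he]; ring, fun k hkj => ?_⟩
      have h1 := hidx k (by rw [hmaj1]; exact hkj)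
      have h2 := hk k hkj
      constructor
      · calc 2 ^ (e + 1) * tIdx (par^[t] (par q)) k = 2 * (2 ^ e * tIdx (par^[t] (par q)) k) := by ring
          _ ≤ 2 * tIdx (par q) k := Nat.mul_le_mul_left 2 h1.1
          _ ≤ tIdx q k := h2.1
      · calc tIdx q k + 2 ≤ 2 * (tIdx (par q) k + 2) := by omega
          _ ≤ 2 * (2 ^ e * (tIdx (par^[t] (par q)) k + 2)) := Nat.mul_le_mul_left 2 h1.2
          _ = 2 ^ (e + 1) * (tIdx (par^[t] (par q)) k + 2) := by ring

/-! ## §6 Counting boxes: the descendants of `p` in the shell `2^e N` -/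

/-- The transverse values `a ∈ [−m, m]` at height `m` (shell `M`) whose tube index lies in `[lo, hi]`.
[cite: Federbush1987PhaseCellIII, §5.4 B) Radial Property 3 p. 307] -/
def window (m M lo hi : ℕ) : Finset ℤ :=
  (Finset.Icc (-(m : ℤ)) m).filter fun a => lo ≤ ti a.natAbs m M ∧ ti a.natAbs m M ≤ hi

/-- The same on absolute values. [cite: Federbush1987PhaseCellIII, §5.4 B) Radial Property 3 p. 307] -/
def natWindow (m M lo hi : ℕ) : Finset ℕ :=
  (Finset.range (m + 1)).filter fun b => lo ≤ ti b m M ∧ ti b m M ≤ hi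

/-- Each tube meets a height in at most `9` absolute values, so a window of `hi + 1 − lo` tubes in at most
`9(hi + 1 − lo)`. [cite: Federbush1987PhaseCellIII, §5.4 B) Radial Property 3 p. 307] -/
theorem card_natWindow_le {m M : ℕ} (hM : 0 < M) (hm : m < 2 * M) (lo hi : ℕ) :
    (natWindow m M lo hi).card ≤ 9 * (hi + 1 - lo) := by
  have hsub : natWindow m M lo hi ⊆
      (Finset.Icc lo hi).biUnion fun u => Finset.Icc (sv u m M) (sv u m M + 8) := by
    intro b hb
    simp only [natWindow, Finset.mem_filter, Finset.mem_range] at hb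
    simp only [Finset.mem_biUnion, Finset.mem_Icc]
    exact ⟨ti b m M, ⟨hb.2.1, hb.2.2⟩, sv_ti_le b m M, le_sv_ti_add hM hm (by omega)⟩
  calc (natWindow m M lo hi).card
      ≤ ((Finset.Icc lo hi).biUnion fun u => Finset.Icc (sv u m M) (sv u m M + 8)).card :=
        Finset.card_le_card hsub
    _ ≤ ∑ u ∈ Finset.Icc lo hi, (Finset.Icc (sv u m M) (sv u m M + 8)).card := Finset.card_biUnion_le
    _ = ∑ _u ∈ Finset.Icc lo hi, 9 := by
        apply Finset.sum_congr rfl; intro u _; rw [Nat.card_Icc]; omega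
    _ = 9 * (hi + 1 - lo) := by rw [Finset.sum_const, Nat.card_Icc, smul_eq_mul, mul_comm]

/-- The signed window is at most twice as large. [cite: Federbush1987PhaseCellIII, §5.4 B) Radial Property 3 p. 307] -/
theorem card_window_le {m M : ℕ} (hM : 0 < M) (hm : m < 2 * M) (lo hi : ℕ) :
    (window m M lo hi).card ≤ 2 * (9 * (hi + 1 - lo)) := by
  have hsub : window m M lo hi ⊆
      (natWindow m M lo hi).image (fun b : ℕ => (b : ℤ)) ∪
        (natWindow m M lo hi).image (fun b : ℕ => -(b : ℤ)) := by
    intro a ha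
    simp only [window, Finset.mem_filter, Finset.mem_Icc] at ha
    have hb : a.natAbs ∈ natWindow m M lo hi := by
      simp only [natWindow, Finset.mem_filter, Finset.mem_range]
      exact ⟨by omega, ha.2⟩
    rw [Finset.mem_union, Finset.mem_image, Finset.mem_image]
    rcases Int.natAbs_eq a with h | h
    · exact Or.inl ⟨a.natAbs, hb, h.symm⟩
    · exact Or.inr ⟨a.natAbs, hb, h.symm⟩
  calc (window m M lo hi).card ≤ _ := Finset.card_le_card hsub
    _ ≤ ((natWindow m M lo hi).image (fun b : ℕ => (b : ℤ))).card +
          ((natWindow m M lo hi).image (fun b : ℕ => -(b : ℤ))).card := Finset.card_union_le _ _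
    _ ≤ (natWindow m M lo hi).card + (natWindow m M lo hi).card :=
        Nat.add_le_add Finset.card_image_le Finset.card_image_le
    _ ≤ 2 * (9 * (hi + 1 - lo)) := by have := card_natWindow_le hM hm lo hi; omega

/-- The box containing every descendant of `p` whose shell is `2^e` times the shell of `p`: same face, height in the
shell, every transverse coordinate in the window of tube indices `[2^e u_k(p), 2^e(u_k(p)+2) − 2]`.
[cite: Federbush1987PhaseCellIII, §5.4 B) Radial Property 3 p. 307] -/
def box (p : Fin (n + 1) → ℤ) (e : ℕ) : Finset (Fin (n + 1) → ℤ) :=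
  (Finset.Ico (2 ^ e * shell (supNorm p)) (2 * (2 ^ e * shell (supNorm p))) ×ˢ ({1, -1} : Finset ℤ)).biUnion
    fun ms => Fintype.piFinset fun k =>
      if k = major p then {ms.2 * (ms.1 : ℤ)}
      else window ms.1 (2 ^ e * shell (supNorm p)) (2 ^ e * tIdx p k) (2 ^ e * (tIdx p k + 2) - 2)

/-- The box of the shell `2^eN` has at most `2^{e+1}N·(36·2^e)^d` points.
[cite: Federbush1987PhaseCellIII, §5.4 B) Radial Property 3 p. 307] -/
theorem card_box_le (p : Fin (n + 1) → ℤ) (e : ℕ) :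
    (box p e).card ≤ 2 * (2 ^ e * shell (supNorm p)) * (36 * 2 ^ e) ^ (n + 1) := by
  set M := 2 ^ e * shell (supNorm p) with hM
  have hMpos : 0 < M := Nat.mul_pos (by positivity) (shell_pos _)
  unfold box
  rw [← hM]
  calc _ ≤ ∑ ms ∈ Finset.Ico M (2 * M) ×ˢ ({1, -1} : Finset ℤ), (36 * 2 ^ e) ^ (n + 1) := by
        refine Finset.card_biUnion_le.trans (Finset.sum_le_sum fun ms hms => ?_)
        rw [Fintype.card_piFinset]
        have hm : ms.1 < 2 * M := (Finset.mem_Ico.1 (Finset.mem_product.1 hms).1).2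
        calc ∏ k, (if k = major p then ({ms.2 * (ms.1 : ℤ)} : Finset ℤ)
              else window ms.1 M (2 ^ e * tIdx p k) (2 ^ e * (tIdx p k + 2) - 2)).card
            ≤ (36 * 2 ^ e) ^ (Finset.univ : Finset (Fin (n + 1))).card := by
              apply Finset.prod_le_pow_card
              intro k _
              split_ifs
              · rw [Finset.card_singleton]
                have : 0 < 2 ^ e := by positivity
                omega
              · refine (card_window_le hMpos hm _ _).trans ?_
                have h2 : 2 ^ e * (tIdx p k + 2) - 2 + 1 - 2 ^ e * tIdx p k = 2 * 2 ^ e - 1 := by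
                  have : 2 ≤ 2 * 2 ^ e := by have : 1 ≤ 2 ^ e := Nat.one_le_two_pow; omega
                  rw [Nat.mul_add]; omega
                rw [h2]; omega
          _ = (36 * 2 ^ e) ^ (n + 1) := by rw [Finset.card_univ, Fintype.card_fin]
    _ = 2 * M * (36 * 2 ^ e) ^ (n + 1) := by
        rw [Finset.sum_const, smul_eq_mul, Finset.card_product, Nat.card_Ico]
        norm_num; ring_nf; omega

/-- Every descendant of `p ≠ 0` lies in the box of its shell. [cite: Federbush1987PhaseCellIII, §5.4 B) Radial Property 3
p. 307] -/
theorem mem_box_of_iterate {p q : Fin (n + 1) → ℤ} {t : ℕ} (hp : p ≠ 0) (ht : par^[t] q = p) :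
    ∃ e : ℕ, shell (supNorm q) = 2 ^ e * shell (supNorm p) ∧ q ∈ box p e := by
  have hpt : par^[t] q ≠ 0 := by rw [ht]; exact hp
  obtain ⟨hmaj, e, he, hidx⟩ := iterate_data t q hpt
  rw [ht] at hmaj he hidx
  refine ⟨e, he, ?_⟩
  have hq : q ≠ 0 := by
    rintro rfl
    exact hp (ht ▸ (radialMap n).toParentMap.iterate_par_root t)
  set m := supNorm q with hm
  have hmpos : 0 < m := supNorm_pos hq
  have hM : shell m = 2 ^ e * shell (supNorm p) := he
  have hjq : (q (major p)).natAbs = m := by rw [hmaj, natAbs_major]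
  have hmIco : m ∈ Finset.Ico (2 ^ e * shell (supNorm p)) (2 * (2 ^ e * shell (supNorm p))) := by
    rw [Finset.mem_Ico, ← hM]; exact ⟨shell_le hmpos.ne', lt_two_mul_shell m⟩
  have htrans : ∀ k, k ≠ major p →
      q k ∈ window m (2 ^ e * shell (supNorm p)) (2 ^ e * tIdx p k) (2 ^ e * (tIdx p k + 2) - 2) := by
    intro k hk
    have h1 := hidx k (by rw [← hmaj]; exact hk)
    have h2 := natAbs_le_supNorm q k
    simp only [window, Finset.mem_filter, Finset.mem_Icc]
    refine ⟨⟨by omega, by omega⟩, ?_⟩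
    rw [← hM]
    change 2 ^ e * tIdx p k ≤ tIdx q k ∧ tIdx q k ≤ 2 ^ e * (tIdx p k + 2) - 2
    omega
  unfold box
  rw [Finset.mem_biUnion]
  rcases Int.natAbs_eq (q (major p)) with hsgn | hsgn
  · refine ⟨(m, 1), Finset.mem_product.2 ⟨hmIco, by simp⟩, ?_⟩
    rw [Fintype.mem_piFinset]
    intro k
    split_ifs with hk
    · rw [Finset.mem_singleton, hk, hsgn, hjq]; simp
    · exact htrans k hk
  · refine ⟨(m, -1), Finset.mem_product.2 ⟨hmIco, by simp⟩, ?_⟩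
    rw [Fintype.mem_piFinset]
    intro k
    split_ifs with hk
    · rw [Finset.mem_singleton, hk, hsgn, hjq]; simp
    · exact htrans k hk

/-! ## §7 Radial Property 3 and the existence of a radial maximal tree -/

/-- A geometric sum with ratio `≥ 2` is at most twice its last term. [cite: Federbush1987PhaseCellIII, §5.4 B) Radial
Property 3 p. 307] -/
theorem geom_sum_le {r : ℕ} (hr : 2 ≤ r) (E : ℕ) : ∑ e ∈ Finset.range (E + 1), r ^ e ≤ 2 * r ^ E := by
  induction E with
  | zero => simp
  | succ E ih =>
    rw [Finset.sum_range_succ]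
    have h1 : 2 * r ^ E ≤ r ^ (E + 1) := by
      rw [pow_succ, mul_comm]; exact Nat.mul_le_mul_left _ hr
    omega

/-- `‖q‖_∞ ≤ |q|`. [cite: Federbush1987PhaseCellIII, §5.4 B) p. 307] -/
theorem supNorm_le_enorm (q : Fin (n + 1) → ℤ) : (supNorm q : ℝ) ≤ enorm q := by
  rw [← natAbs_major q]; exact LatticeParentMap.natAbs_le_enorm q (major q)

/-- `|q| ≤ d·‖q‖_∞`. [cite: Federbush1987PhaseCellIII, §5.4 B) p. 307] -/
theorem enorm_le_mul_supNorm (q : Fin (n + 1) → ℤ) : enorm q ≤ (n + 1 : ℕ) * (supNorm q : ℝ) := by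
  have hs : ∀ i, ((q i : ℝ)) ^ 2 ≤ ((supNorm q : ℕ) : ℝ) ^ 2 := by
    intro i
    have h := natAbs_le_supNorm q i
    have h1 : -(supNorm q : ℤ) ≤ q i ∧ q i ≤ supNorm q := by omega
    have h2 : -((supNorm q : ℕ) : ℝ) ≤ (q i : ℝ) := by exact_mod_cast h1.1
    have h3 : (q i : ℝ) ≤ ((supNorm q : ℕ) : ℝ) := by exact_mod_cast h1.2
    exact sq_le_sq' h2 h3
  have hpos : (0 : ℝ) ≤ (n + 1 : ℕ) * (supNorm q : ℝ) := by positivity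
  unfold enorm
  calc Real.sqrt (∑ i, ((q i : ℝ)) ^ 2) ≤ Real.sqrt (((n + 1 : ℕ) * (supNorm q : ℝ)) ^ 2) := by
        apply Real.sqrt_le_sqrt
        calc ∑ i, ((q i : ℝ)) ^ 2 ≤ ∑ _i : Fin (n + 1), ((supNorm q : ℕ) : ℝ) ^ 2 :=
              Finset.sum_le_sum fun i _ => hs i
          _ = (n + 1 : ℕ) * ((supNorm q : ℕ) : ℝ) ^ 2 := by simp
          _ ≤ ((n + 1 : ℕ) * (supNorm q : ℝ)) ^ 2 := by
              rw [mul_pow]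
              apply mul_le_mul_of_nonneg_right _ (sq_nonneg _)
              have : (1 : ℝ) ≤ (n + 1 : ℕ) := by exact_mod_cast Nat.succ_le_succ (Nat.zero_le n)
              nlinarith
    _ = (n + 1 : ℕ) * (supNorm q : ℝ) := Real.sqrt_sq hpos

/-- **Radial Property 3 for the constructed tree** (the descendant count of stage A): for `|p| ≥ r`, the strict
descendants of `p` in the ball of radius `c₀r` number at most `4(72d)^d c₀^{d+1}·r`.
[cite: Federbush1987PhaseCellIII, Radial Property 3 p. 307] -/
theorem count_bound (c₀ : ℝ) (hc₀ : 1 < c₀) (r : ℝ) (hr : 0 < r) (p : Fin (n + 1) → ℤ) (hp : r ≤ enorm p) :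
    ({q : Fin (n + 1) → ℤ | q ≠ p ∧ (radialMap n).toParentMap.IsAnc p q ∧ enorm q ≤ c₀ * r}.ncard : ℝ) ≤
      (4 * (72 * (n + 1 : ℕ)) ^ (n + 1) * c₀ ^ (n + 2)) * r := by
  have hp0 : p ≠ 0 := by
    rintro rfl
    have : enorm (0 : Fin (n + 1) → ℤ) = 0 := by simp [enorm]
    rw [this] at hp; linarith
  set N := shell (supNorm p) with hN
  have hNpos : 0 < N := shell_pos _
  set R := c₀ * r with hR
  have hRpos : 0 < R := by rw [hR]; exact mul_pos (by linarith) hr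
  set S := {q : Fin (n + 1) → ℤ | q ≠ p ∧ (radialMap n).toParentMap.IsAnc p q ∧ enorm q ≤ R} with hS
  have hmpos : (0 : ℝ) ≤ (4 * (72 * (n + 1 : ℕ)) ^ (n + 1) * c₀ ^ (n + 2)) * r := by
    have : (0 : ℝ) ≤ c₀ := by linarith
    positivity
  -- every member of `S` lies in the box of its shell, which is below `⌊R⌋`
  have hmem : ∀ q ∈ S, ∃ e, q ∈ box p e ∧ 2 ^ e * N ≤ ⌊R⌋₊ := by
    intro q hq
    obtain ⟨-, ⟨t, ht⟩, hqR⟩ := hq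
    have ht' : par^[t] q = p := ht
    obtain ⟨e, he, hbox⟩ := mem_box_of_iterate hp0 ht'
    refine ⟨e, hbox, ?_⟩
    rw [← he]
    have hq0 : q ≠ 0 := by
      rintro rfl
      exact hp0 (ht'.symm.trans ((radialMap n).toParentMap.iterate_par_root t))
    have h1 : shell (supNorm q) ≤ supNorm q := shell_le (supNorm_pos hq0).ne'
    have h2 : (supNorm q : ℝ) ≤ R := (supNorm_le_enorm q).trans hqR
    exact h1.trans (Nat.le_floor h2)
  by_cases hRN : N ≤ ⌊R⌋₊
  · set E := Nat.log 2 (⌊R⌋₊ / N) with hE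
    have hsub : S ⊆ ↑((Finset.range (E + 1)).biUnion (box p)) := by
      intro q hq
      obtain ⟨e, hbox, he⟩ := hmem q hq
      simp only [Finset.coe_biUnion, Finset.coe_range, Set.mem_iUnion, Set.mem_Iio, Finset.mem_coe]
      refine ⟨e, ?_, hbox⟩
      have h1 : 2 ^ e ≤ ⌊R⌋₊ / N := (Nat.le_div_iff_mul_le hNpos).2 he
      have h2 := Nat.le_log_of_pow_le (b := 2) one_lt_two h1
      omega
    have hcard : S.ncard ≤ 4 * 36 ^ (n + 1) * N * (2 ^ E) ^ (n + 2) := by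
      calc S.ncard ≤ (((Finset.range (E + 1)).biUnion (box p) : Finset _) : Set _).ncard :=
            Set.ncard_le_ncard hsub (Finset.finite_toSet _)
        _ = ((Finset.range (E + 1)).biUnion (box p)).card := Set.ncard_coe_finset _
        _ ≤ ∑ e ∈ Finset.range (E + 1), (box p e).card := Finset.card_biUnion_le
        _ ≤ ∑ e ∈ Finset.range (E + 1), 2 * (2 ^ e * N) * (36 * 2 ^ e) ^ (n + 1) :=
            Finset.sum_le_sum fun e _ => card_box_le p e
        _ = ∑ e ∈ Finset.range (E + 1), 2 * N * 36 ^ (n + 1) * (2 ^ (n + 2)) ^ e := by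
            apply Finset.sum_congr rfl; intro e _
            rw [mul_pow, ← pow_mul, ← pow_mul]; ring
        _ = 2 * N * 36 ^ (n + 1) * ∑ e ∈ Finset.range (E + 1), (2 ^ (n + 2)) ^ e := by
            rw [Finset.mul_sum]
        _ ≤ 2 * N * 36 ^ (n + 1) * (2 * (2 ^ (n + 2)) ^ E) := by
            apply Nat.mul_le_mul_left
            apply geom_sum_le
            calc 2 = 2 ^ 1 := rfl
              _ ≤ 2 ^ (n + 2) := Nat.pow_le_pow_right (by norm_num) (by omega)
        _ = 4 * 36 ^ (n + 1) * N * (2 ^ E) ^ (n + 2) := by rw [← pow_mul, ← pow_mul]; ring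
    -- the real-number assembly
    have hXN : (((2 ^ E * N : ℕ)) : ℝ) ≤ R := by
      have h0 : ⌊R⌋₊ / N ≠ 0 := by
        intro h; rw [Nat.div_eq_zero_iff_lt hNpos] at h; omega
      have h1 : 2 ^ E ≤ ⌊R⌋₊ / N := Nat.pow_log_le_self 2 h0
      have h2 : 2 ^ E * N ≤ ⌊R⌋₊ := (Nat.le_div_iff_mul_le hNpos).1 h1
      calc (((2 ^ E * N : ℕ)) : ℝ) ≤ (⌊R⌋₊ : ℝ) := by exact_mod_cast h2
        _ ≤ R := Nat.floor_le hRpos.le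
    have hrN : r ≤ 2 * (n + 1 : ℕ) * (N : ℝ) := by
      have h2 : (supNorm p : ℝ) ≤ 2 * (N : ℝ) := by
        exact_mod_cast (lt_two_mul_shell (supNorm p)).le
      calc r ≤ enorm p := hp
        _ ≤ (n + 1 : ℕ) * (supNorm p : ℝ) := enorm_le_mul_supNorm p
        _ ≤ (n + 1 : ℕ) * (2 * (N : ℝ)) := by gcongr
        _ = 2 * (n + 1 : ℕ) * (N : ℝ) := by ring
    set X : ℝ := ((2 ^ E : ℕ) : ℝ) with hX
    have hNX : (N : ℝ) * X ≤ c₀ * r := by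
      rw [hX]
      calc (N : ℝ) * ((2 ^ E : ℕ) : ℝ) = (((2 ^ E * N : ℕ)) : ℝ) := by push_cast; ring
        _ ≤ R := hXN
    have hNn : (0 : ℝ) < (N : ℝ) ^ (n + 1) := by positivity
    have key : (N : ℝ) * X ^ (n + 2) ≤ (2 * (n + 1 : ℕ)) ^ (n + 1) * c₀ ^ (n + 2) * r := by
      refine le_of_mul_le_mul_right ?_ hNn
      have hc : (0 : ℝ) ≤ c₀ := by linarith
      calc (N : ℝ) * X ^ (n + 2) * (N : ℝ) ^ (n + 1) = ((N : ℝ) * X) ^ (n + 2) := by ring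
        _ ≤ (c₀ * r) ^ (n + 2) := by gcongr
        _ = c₀ ^ (n + 2) * r * r ^ (n + 1) := by ring
        _ ≤ c₀ ^ (n + 2) * r * (2 * (n + 1 : ℕ) * (N : ℝ)) ^ (n + 1) := by gcongr
        _ = (2 * (n + 1 : ℕ)) ^ (n + 1) * c₀ ^ (n + 2) * r * (N : ℝ) ^ (n + 1) := by ring
    calc (S.ncard : ℝ) ≤ ((4 * 36 ^ (n + 1) * N * (2 ^ E) ^ (n + 2) : ℕ) : ℝ) := by exact_mod_cast hcard
      _ = 4 * 36 ^ (n + 1) * ((N : ℝ) * X ^ (n + 2)) := by rw [hX]; push_cast; ring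
      _ ≤ 4 * 36 ^ (n + 1) * ((2 * (n + 1 : ℕ)) ^ (n + 1) * c₀ ^ (n + 2) * r) := by gcongr
      _ = (4 * (72 * (n + 1 : ℕ)) ^ (n + 1) * c₀ ^ (n + 2)) * r := by
          rw [show (72 : ℝ) * (n + 1 : ℕ) = 36 * (2 * (n + 1 : ℕ)) by ring]
          simp only [mul_pow]; ring
  · -- nothing of `S` fits below `R`: `S = ∅`
    have hempty : S = ∅ := by
      ext q
      simp only [Set.mem_empty_iff_false, iff_false]
      intro hq
      obtain ⟨e, -, he⟩ := hmem q hq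
      have : N ≤ 2 ^ e * N := Nat.le_mul_of_pos_left N (by positivity)
      omega
    rw [hempty, Set.ncard_empty, Nat.cast_zero]
    exact hmpos

/-- The constructed tree is RADIAL (Radial Properties 1–3). [cite: Federbush1987PhaseCellIII, §5.4 B) Radial Properties
1–3 p. 307] -/
theorem isRadial_radialMap (n : ℕ) : IsRadial (radialMap n).tree :=
  (radialMap n).isRadial_of_count fun c₀ hc₀ =>
    ⟨4 * (72 * (n + 1 : ℕ)) ^ (n + 1) * c₀ ^ (n + 2), fun r hr p hp => count_bound c₀ hc₀ r hr p hp⟩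

end Construction

/-- **Existence of a radial maximal tree of `ℤ^d`** for every `d ≥ 1` — row F3.Txt@307 PROVED AS TYPED: the tree of the
parent map `Construction.par` (dyadic sup-norm shells, digital-ray spines `⌊3um/N⌋`, coordinate-monotone attachment,
one bond per spine into the shell below) is a maximal tree of `latticeGraph d` with Radial Property 1 (`c_a = d`),
Radial Property 2 (`c_b = 0`) and Radial Property 3 (`m(c₀) = 4(72d)^d c₀^{d+1}`). [cite: Federbush1987PhaseCellIII,
§5.4 B) «Construction of a Radial Maximal Tree» pp. 307–308] -/
theorem radialTreeExists : RadialTreeExists := by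
  intro d hd
  obtain ⟨n, rfl⟩ := Nat.exists_eq_succ_of_ne_zero (by omega : d ≠ 0)
  exact ⟨(Construction.radialMap n).tree, (Construction.radialMap n).isMaximalTree,
    Construction.isRadial_radialMap n⟩

end

end RadialTree

end Literature.MathematicalPhysics.QuantumFieldTheory.Federbush1986

/-! ## `_holds` aliases (appended 2026-08-28)

The named fact(s) below are already theorems of the tree under another name; the `_holds`
alias records the discharge under the tree's naming convention (D-0026 bookkeeping: proof term =
the existing theorem, no statement or definition edited). -/

/-- `RadialTreeExists` is a theorem of the tree (`Literature.MathematicalPhysics.QuantumFieldTheory.Federbush1986.RadialTree.radialTreeExists`). [cite: Federbush1987PhaseCellIII, §5.4 B) Construction pp. 307–308] -/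
theorem _root_.Literature.MathematicalPhysics.QuantumFieldTheory.Federbush1986.RadialTree.RadialTreeExists_holds : _root_.Literature.MathematicalPhysics.QuantumFieldTheory.Federbush1986.RadialTree.RadialTreeExists :=
  _root_.Literature.MathematicalPhysics.QuantumFieldTheory.Federbush1986.RadialTree.radialTreeExists
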